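import Mathlib
import Summits.ValiantsHypothesis.ValiantsHypothesis.Theorems.FeketeSOSFeketeNoSparseSplitCharPFewnomial
import Summits.ValiantsHypothesis.ValiantsHypothesis.Theorems.FeketeSOSCharPSparseSOSTwoCuspTrivial
import Summits.ValiantsHypothesis.ValiantsHypothesis.Theorems.FeketeSOSCharPSparseSOSTwoCuspSLeTwo

/-!
# Crux `FeketeSOS.CharPSparseSOS` (stmt-ValiantsHypothesis-14989), line `Sketch` — one weighted
square against a sparse polynomial at the upper cusp (`squareVsSparse_oneCusp`)

Over a field `K` of characteristic `p`, let `P = (c₀ C² − B) mod (X^p − 1)` with `deg C, deg B < p`,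
`t = #supp C`, `k = #supp B`.  If `P ≠ 0` and `(X − 1)^D ∣ P`, then either `D ≤ (k + 2) t + k`, or
`P` vanishes at `1` to order `≥ p + 2 − k` (the "socle window": `p + 2 ≤ ord₁ P + k`).

Proof (operator mechanism).  The first-order operator `𝒟 f = 2 B f′ − B′ f` satisfies the polynomial
identity `c₀ C · 𝒟C = B F′ − B′ F` for `F = c₀ C² − B`, and `𝒟C` is supported on
`{a + b − 1 : a ∈ supp B, b ∈ supp C}`, so it has at most `k t` monomials.
* `P ≠ 0` gives `D ≤ deg P < p`, and `X^p − 1 = (X − 1)^p`, so `(X − 1)^D ∣ F` as well.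
* Degenerate cases: `c₀ C² = 0` (then `F = −B` and `D + 1 ≤ k` by the char-`p` fewnomial bound
  `cpf_main`), `B = 0` (one weighted square, `D + 2 ≤ 2t`), and `D ≤ ord₁ C + 1 ≤ t`.
* Otherwise `(X − 1)^{D−1} ∣ B F′ − B′ F = c₀ C · 𝒟C`, so `(X − 1)^{D−1−ord₁ C} ∣ 𝒟C`, hence also
  divides its fold `V = 𝒟C mod (X^p − 1)` (`#supp V ≤ k t`, `deg V < p`).  If `V ≠ 0`, `cpf_main`
  gives `D − ord₁ C ≤ k t`, so `D ≤ k t + t − 1`.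
* If `V = 0` then `X^p − 1 ∣ B F′ − B′ F ≡ B P′ − B′ P` (the derivative of `X^p − 1` vanishes in
  characteristic `p`), i.e. `(X − 1)^p ∣ B P′ − B′ P`.  Writing `B = (X − 1)^b B₁`, `P = (X − 1)^π P₁`
  with `B₁(1) P₁(1) ≠ 0` (`b = ord₁ B ≤ k − 1`, `π = ord₁ P ≥ D`),
  `(X − 1)(B P′ − B′ P) = (X − 1)^{b+π} ((π − b) B₁ P₁ + (X − 1)(B₁ P₁′ − B₁′ P₁))`.
  If `π = b` then `D ≤ k − 1`; otherwise `π ≠ b` in `K` (both are `< p`), the last factor does not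
  vanish at `1`, and `p + 1 ≤ b + π ≤ (k − 1) + ord₁ P`.
-/

-- `Summit.ValiantsHypothesis.ValiantsHypothesis.…` is the tree's mandated single-conjunct layout (Sub = Summit).
set_option linter.dupNamespace false

namespace Summit.ValiantsHypothesis.ValiantsHypothesis.Theorems.CharPSparseSOSTwoCusp

open Polynomial Finset
open Summit.ValiantsHypothesis.ValiantsHypothesis.Theorems.FeketeNoSparseSplitCyclic (cpf_main)

section Operator

variable {K : Type*} [Field K]

/-- **The operator identity.**  For `F = c₀ C² − B` and `𝒟C = 2 B C′ − B′ C`: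
`c₀ C · 𝒟C = B F′ − B′ F` (no square roots needed). -/
theorem svs_operator_identity (c₀ : K) (Cq B : K[X]) :
    C c₀ * Cq * (2 * (B * derivative Cq) - derivative B * Cq)
      = B * derivative (C c₀ * Cq ^ 2 - B) - derivative B * (C c₀ * Cq ^ 2 - B) := by
  simp only [sq, derivative_sub, derivative_mul, derivative_C, zero_mul, zero_add]
  ring

/-- The supports of `f · g′` and of `f′ · g` both lie in `{a + b − 1 : a ∈ supp f, b ∈ supp g}`. -/
theorem svs_support_mul_derivative_subset (f g : K[X]) :
    (f * derivative g).support ∪ (derivative f * g).support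
      ⊆ (f.support ×ˢ g.support).image fun x => x.1 + x.2 - 1 := by
  refine union_subset (fun n hn => ?_) (fun n hn => ?_)
  · rw [Polynomial.mem_support_iff, coeff_mul] at hn
    obtain ⟨⟨i, j⟩, hij, hne⟩ := Finset.exists_ne_zero_of_sum_ne_zero hn
    rw [HasAntidiagonal.mem_antidiagonal] at hij
    rw [coeff_derivative] at hne
    refine mem_image.2 ⟨(i, j + 1), mem_product.2 ⟨Polynomial.mem_support_iff.2
      (left_ne_zero_of_mul hne), Polynomial.mem_support_iff.2
      (left_ne_zero_of_mul (right_ne_zero_of_mul hne))⟩, ?_⟩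
    dsimp only at hij ⊢
    omega
  · rw [Polynomial.mem_support_iff, coeff_mul] at hn
    obtain ⟨⟨i, j⟩, hij, hne⟩ := Finset.exists_ne_zero_of_sum_ne_zero hn
    rw [HasAntidiagonal.mem_antidiagonal] at hij
    rw [coeff_derivative] at hne
    refine mem_image.2 ⟨(i + 1, j), mem_product.2 ⟨Polynomial.mem_support_iff.2
      (left_ne_zero_of_mul (left_ne_zero_of_mul hne)), Polynomial.mem_support_iff.2
      (right_ne_zero_of_mul hne)⟩, ?_⟩
    dsimp only at hij ⊢
    omega

/-- **Sparsity of `𝒟C = 2 B C′ − B′ C`**: at most `#supp B · #supp C` monomials. -/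
theorem svs_card_support_operator_le (f g : K[X]) :
    (2 * (f * derivative g) - derivative f * g).support.card ≤ f.support.card * g.support.card := by
  have h := svs_support_mul_derivative_subset f g
  calc (2 * (f * derivative g) - derivative f * g).support.card
      ≤ ((f.support ×ˢ g.support).image fun x => x.1 + x.2 - 1).card := by
        refine card_le_card (_root_.trans ?_ h)
        rw [two_mul, sub_eq_add_neg]
        refine support_add.trans (union_subset_union (support_add.trans ?_) (by rw [support_neg]))
        exact union_subset Subset.rfl Subset.rfl
    _ ≤ (f.support ×ˢ g.support).card := card_image_le
    _ = f.support.card * g.support.card := card_product _ _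

/-- `(X − 1) · ((X − 1)^m)′ = m · (X − 1)^m` (valid for `m = 0` too). -/
theorem svs_X_sub_C_mul_derivative_pow (m : ℕ) :
    (X - C (1 : K)) * derivative ((X - C (1 : K)) ^ m) = C (m : K) * (X - C 1) ^ m := by
  cases m with
  | zero => simp
  | succ m =>
    rw [derivative_pow_succ, derivative_X_sub_C, mul_one, pow_succ]
    push_cast
    ring

/-- **Wronskian of two `(X − 1)`-adic factorizations.**  For `B = (X − 1)^m B₁`, `P = (X − 1)^n P₁`:
`(X − 1) · (B P′ − B′ P) = (X − 1)^{m+n} · ((n − m) B₁ P₁ + (X − 1)(B₁ P₁′ − B₁′ P₁))`. -/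
theorem svs_wronskian_expand (m n : ℕ) (B₁ P₁ : K[X]) :
    (X - C (1 : K)) * (((X - C 1) ^ m * B₁) * derivative ((X - C 1) ^ n * P₁)
        - derivative ((X - C 1) ^ m * B₁) * ((X - C 1) ^ n * P₁))
      = (X - C (1 : K)) ^ (m + n) * ((C (n : K) - C (m : K)) * B₁ * P₁
          + (X - C 1) * (B₁ * derivative P₁ - derivative B₁ * P₁)) := by
  rw [derivative_mul, derivative_mul]
  linear_combination ((X - C (1 : K)) ^ m * B₁ * P₁) * svs_X_sub_C_mul_derivative_pow (K := K) n
    - ((X - C (1 : K)) ^ n * B₁ * P₁) * svs_X_sub_C_mul_derivative_pow (K := K) m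

/-- Naturals `< p` with equal images in a ring of characteristic `p` are equal. -/
theorem svs_natCast_sub_natCast_ne_zero (p : ℕ) [CharP K p] {a b : ℕ} (ha : a < p) (hb : b < p)
    (hab : a ≠ b) : (a : K) - (b : K) ≠ 0 := fun h =>
  hab (CharP.natCast_injOn_Iio K p ha hb (sub_eq_zero.1 h))

end Operator

/-- **One weighted square against a sparse polynomial, upper cusp.**  Over a field `K` of
characteristic `p`, let `P = (c₀ C² − B) mod (X^p − 1)` with `deg C, deg B < p`.  If `P ≠ 0` and
`(X − 1)^D ∣ P`, then `D ≤ (#supp B + 2) · #supp C + #supp B`, unless `P` vanishes at `1` to order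
at least `p + 2 − #supp B`. -/
theorem squareVsSparse_oneCusp :
    ∀ (K : Type) [Field K] (p : ℕ) [Fact p.Prime] [CharP K p] (c₀ : K) (Cq B P : K[X]) (D : ℕ),
      Cq.natDegree < p → B.natDegree < p → P = (C c₀ * Cq ^ 2 - B) %ₘ (X ^ p - 1) → P ≠ 0 →
      (X - C (1 : K)) ^ D ∣ P →
      D ≤ (B.support.card + 2) * Cq.support.card + B.support.card ∨
        p + 2 ≤ P.rootMultiplicity 1 + B.support.card := by
  intro K _ p _ _ c₀ Cq B P D hdegC hdegB hP hP0 hD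
  have hprime : p.Prime := Fact.out
  have hp : 0 < p := hprime.pos
  have hmonic : ((X : K[X]) ^ p - 1).Monic :=
    monic_X_pow_sub (by rw [degree_one]; exact_mod_cast hp)
  -- Folds modulo `X^p − 1` have degree `< p`.
  have hdeg_fold : ∀ f : K[X], (f %ₘ ((X : K[X]) ^ p - 1)).natDegree < p := fun f => by
    have hq1 : ((X : K[X]) ^ p - 1) ≠ 1 := by
      intro h
      have h' := congrArg natDegree h
      rw [← C_1, natDegree_X_pow_sub_C, natDegree_C] at h'
      omega
    have h := natDegree_modByMonic_lt f hmonic hq1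
    rwa [← C_1, natDegree_X_pow_sub_C] at h
  -- `(X − 1)^m ∣ f ≠ 0` forces `m ≤ deg f`.
  have hdeg_dvd : ∀ (f : K[X]) (m : ℕ), f ≠ 0 → (X - C (1 : K)) ^ m ∣ f → m ≤ f.natDegree :=
    fun f m hf hm => by
      have h := natDegree_le_of_dvd hm hf
      rwa [(monic_X_sub_C (1 : K)).natDegree_pow, natDegree_X_sub_C, mul_one] at h
  have hdegP : P.natDegree < p := hP ▸ hdeg_fold _
  have hDp : D < p := lt_of_le_of_lt (hdeg_dvd P D hP0 hD) hdegP
  -- Frobenius: `X^p − 1 = (X − 1)^p`, so for `m ≤ p`, `(X − 1)^m ∣ f` iff it divides the fold of `f`.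
  have hXp : (X - C (1 : K)) ^ p = X ^ p - 1 := by
    rw [sub_pow_char, ← C_pow, one_pow, C_1]
  have hfold_dvd : ∀ (f : K[X]) (m : ℕ), m ≤ p →
      ((X - C (1 : K)) ^ m ∣ f %ₘ (X ^ p - 1) ↔ (X - C (1 : K)) ^ m ∣ f) := fun f m hm => by
    have h : (X - C (1 : K)) ^ m ∣ (X ^ p - 1) * (f /ₘ (X ^ p - 1)) := by
      refine dvd_mul_of_dvd_left ?_ _
      rw [← hXp]
      exact pow_dvd_pow _ hm
    conv_rhs => rw [← modByMonic_add_div f ((X : K[X]) ^ p - 1)]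
    exact (dvd_add_left h).symm
  -- The un-folded difference `F = c₀ C² − B`.
  obtain ⟨F, hF⟩ : ∃ F : K[X], F = C c₀ * Cq ^ 2 - B := ⟨_, rfl⟩
  rw [← hF] at hP
  have hF0 : F ≠ 0 := by
    rintro rfl
    rw [zero_modByMonic] at hP
    exact hP0 hP
  have hDF : (X - C (1 : K)) ^ D ∣ F := (hfold_dvd F D hDp.le).1 (hP ▸ hD)
  have hkt : (B.support.card + 2) * Cq.support.card
      = B.support.card * Cq.support.card + 2 * Cq.support.card := add_mul _ _ _
  -- (i) The square is dead: `F = −B`.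
  by_cases hz : C c₀ * Cq ^ 2 = 0
  · have hFB : F = -B := by rw [hF, hz, zero_sub]
    have hB0 : B ≠ 0 := fun h => hF0 (by rw [hFB, h, neg_zero])
    have h := cpf_main K p D B hB0 hdegB (by rwa [hFB, dvd_neg] at hDF)
    left
    omega
  have hc₀ : c₀ ≠ 0 := fun h => hz (by rw [h, C_0, zero_mul])
  have hCq : Cq ≠ 0 := fun h => hz (by rw [h, zero_pow two_ne_zero, mul_zero])
  have ht1 : 1 ≤ Cq.support.card := card_pos.2 (Polynomial.support_nonempty.2 hCq)
  -- (ii) `B = 0`: one weighted square.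
  by_cases hB0 : B = 0
  · have hFW : F = C c₀ * Cq ^ 2 := by rw [hF, hB0, sub_zero]
    rw [hFW] at hF0 hDF
    have h := tcs_depth_sq_le K p c₀ Cq D hF0 hdegC hDF
    left
    omega
  have hk1 : 1 ≤ B.support.card := card_pos.2 (Polynomial.support_nonempty.2 hB0)
  -- `c = ord₁ C`, `c + 1 ≤ #supp C`; the shallow case `D ≤ c + 1`.
  obtain ⟨c, hc⟩ : ∃ c : ℕ, Cq.rootMultiplicity 1 = c := ⟨_, rfl⟩
  have hct : c + 1 ≤ Cq.support.card :=
    cpf_main K p c Cq hCq hdegC (hc ▸ pow_rootMultiplicity_dvd Cq 1)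
  by_cases hDc : D ≤ c + 1
  · left
    omega
  rw [not_le] at hDc
  -- The operator value `V₀ = 𝒟C = 2 B C′ − B′ C` and the identity `c₀ C · V₀ = B F′ − B′ F`.
  obtain ⟨V₀, hV₀⟩ : ∃ V₀ : K[X], V₀ = 2 * (B * derivative Cq) - derivative B * Cq := ⟨_, rfl⟩
  have hid : C c₀ * Cq * V₀ = B * derivative F - derivative B * F := by
    rw [hV₀, hF]
    exact svs_operator_identity c₀ Cq B
  -- `(X − 1)^{D−1−c} ∣ V₀`.
  have hdvdV₀ : (X - C (1 : K)) ^ (D - 1 - c) ∣ V₀ := by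
    have h1 : (X - C (1 : K)) ^ (D - 1) ∣ derivative F := pow_sub_one_dvd_derivative_of_pow_dvd hDF
    have h2 : (X - C (1 : K)) ^ (D - 1) ∣ F := (pow_dvd_pow _ (Nat.sub_le D 1)).trans hDF
    have h3 : (X - C (1 : K)) ^ (D - 1) ∣ C c₀ * Cq * V₀ := by
      rw [hid]
      exact dvd_sub (dvd_mul_of_dvd_right h1 _) (dvd_mul_of_dvd_right h2 _)
    by_cases hV00 : V₀ = 0
    · rw [hV00]
      exact dvd_zero _
    have hCc : C c₀ * Cq ≠ 0 := mul_ne_zero (C_ne_zero.2 hc₀) hCq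
    have hne : C c₀ * Cq * V₀ ≠ 0 := mul_ne_zero hCc hV00
    have h4 := (le_rootMultiplicity_iff hne).2 h3
    rw [rootMultiplicity_mul hne, rootMultiplicity_mul hCc, rootMultiplicity_C, zero_add, hc] at h4
    exact (pow_dvd_pow _ (by omega)).trans (pow_rootMultiplicity_dvd V₀ 1)
  -- Sparsity: `#supp V₀ ≤ k t`, and the same for its fold `V = V₀ mod (X^p − 1)`.
  have hcardV₀ : V₀.support.card ≤ B.support.card * Cq.support.card :=
    hV₀ ▸ svs_card_support_operator_le B Cq
  have hcardV : (V₀ %ₘ (X ^ p - 1)).support.card ≤ B.support.card * Cq.support.card :=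
    (card_support_fold_le p hp V₀).trans hcardV₀
  have hdvdV : (X - C (1 : K)) ^ (D - 1 - c) ∣ V₀ %ₘ (X ^ p - 1) :=
    (hfold_dvd V₀ _ (by omega)).2 hdvdV₀
  by_cases hVz : V₀ %ₘ (X ^ p - 1) ≠ 0
  · -- (ii-a) The fold is non-zero: Hajós bound for `V`.
    have h := cpf_main K p (D - 1 - c) _ hVz (hdeg_fold V₀) hdvdV
    left
    omega
  -- (ii-b) The fold vanishes: `X^p − 1 ∣ V₀`, hence `(X − 1)^p ∣ B P′ − B′ P`.
  rw [not_ne_iff] at hVz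
  have hqV₀ : (X : K[X]) ^ p - 1 ∣ V₀ := (modByMonic_eq_zero_iff_dvd hmonic).1 hVz
  have hWr : (X - C (1 : K)) ^ p ∣ B * derivative P - derivative B * P := by
    have h1 : (X : K[X]) ^ p - 1 ∣ B * derivative F - derivative B * F := by
      rw [← hid]
      exact dvd_mul_of_dvd_right hqV₀ _
    have hFP : F = P + (X ^ p - 1) * (F /ₘ (X ^ p - 1)) := by
      rw [hP]
      exact (modByMonic_add_div F _).symm
    have hdq : derivative ((X : K[X]) ^ p - 1) = 0 := by
      rw [derivative_sub, derivative_X_pow, CharP.cast_eq_zero, C_0, zero_mul, derivative_one,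
        sub_zero]
    have key : B * derivative F - derivative B * F = (B * derivative P - derivative B * P)
        + (X ^ p - 1) * (B * derivative (F /ₘ (X ^ p - 1)) - derivative B * (F /ₘ (X ^ p - 1))) := by
      conv_lhs => rw [hFP]
      rw [derivative_add, derivative_mul, hdq, zero_mul, zero_add]
      ring
    rw [key] at h1
    rw [hXp]
    exact (dvd_add_left (dvd_mul_right _ _)).1 h1
  -- `b = ord₁ B ≤ k − 1`, `π = ord₁ P ≥ D`, both `< p`.
  obtain ⟨b, hb⟩ : ∃ b : ℕ, B.rootMultiplicity 1 = b := ⟨_, rfl⟩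
  have hbk : b + 1 ≤ B.support.card :=
    cpf_main K p b B hB0 hdegB (hb ▸ pow_rootMultiplicity_dvd B 1)
  have hbp : b < p := by
    have h := card_supp_le_succ_natDegree B
    omega
  obtain ⟨π, hπ⟩ : ∃ π : ℕ, P.rootMultiplicity 1 = π := ⟨_, rfl⟩
  have hDπ : D ≤ π := hπ ▸ (le_rootMultiplicity_iff hP0).2 hD
  have hπp : π < p :=
    lt_of_le_of_lt (hdeg_dvd P π hP0 (hπ ▸ pow_rootMultiplicity_dvd P 1)) hdegP
  by_cases hπb : π = b
  · left
    omega
  right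
  -- `B = (X − 1)^b B₁`, `P = (X − 1)^π P₁` with `B₁(1), P₁(1) ≠ 0`.
  obtain ⟨B₁, hBf, hB₁⟩ := exists_eq_pow_rootMultiplicity_mul_and_not_dvd B hB0 1
  obtain ⟨P₁, hPf, hP₁⟩ := exists_eq_pow_rootMultiplicity_mul_and_not_dvd P hP0 1
  rw [hb] at hBf
  rw [hπ] at hPf
  rw [dvd_iff_isRoot, IsRoot.def] at hB₁ hP₁
  obtain ⟨R, hR⟩ : ∃ R : K[X], R = (C (π : K) - C (b : K)) * B₁ * P₁
      + (X - C 1) * (B₁ * derivative P₁ - derivative B₁ * P₁) := ⟨_, rfl⟩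
  have hexp : (X - C (1 : K)) * (B * derivative P - derivative B * P)
      = (X - C (1 : K)) ^ (b + π) * R := by
    rw [hR, hBf, hPf]
    exact svs_wronskian_expand b π B₁ P₁
  have hR1 : R.eval 1 ≠ 0 := by
    rw [hR]
    simp only [eval_add, eval_mul, eval_sub, eval_C, eval_X, sub_self, zero_mul, add_zero]
    exact mul_ne_zero (mul_ne_zero (svs_natCast_sub_natCast_ne_zero p hπp hbp hπb) hB₁) hP₁
  have hR0 : R ≠ 0 := fun h => hR1 (by rw [h, eval_zero])
  have hprod : (X - C (1 : K)) ^ (b + π) * R ≠ 0 :=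
    mul_ne_zero (pow_ne_zero _ (X_sub_C_ne_zero 1)) hR0
  have hdvd2 : (X - C (1 : K)) ^ (p + 1) ∣ (X - C (1 : K)) ^ (b + π) * R := by
    rw [← hexp, pow_succ']
    exact mul_dvd_mul_left _ hWr
  have h6 := (le_rootMultiplicity_iff hprod).2 hdvd2
  rw [rootMultiplicity_mul hprod, rootMultiplicity_X_sub_C_pow,
    rootMultiplicity_eq_zero (fun h => hR1 (IsRoot.def.1 h)), add_zero] at h6
  omega

end Summit.ValiantsHypothesis.ValiantsHypothesis.Theorems.CharPSparseSOSTwoCusp
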